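import Summits.CriticalPhenomena.SAWScalingLimit.Theses.SAWStressTensor
import Literature.Probability.RandomPlanarGeometry.SLELawOfDrivingProcessLocal
import Literature.Probability.RandomPlanarGeometry.DrivingFunctionMeasurable
import Literature.Probability.RandomPlanarGeometry.CaratheodoryHalfPlaneProofs
import Literature.Probability.RandomPlanarGeometry.ObservableLocalMartingale

/-!
# Line `birth` — registered skeleton for the crux `QuadrupoleIdentification`
(stmt-CriticalPhenomena-7752, rank 4 of `route-CriticalPhenomena-SAWStressTensor`)

Crux (FIXED, by name `Summit.CriticalPhenomena.SAWScalingLimit.Theses.SAWStressTensor.QuadrupoleIdentification`):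

  `SlitQuadrupoleShape → SimpleSubseqLimits → SubseqIdentification`

(the last two inlined verbatim in the route file): granted the slit-domain shape theorem for the
lattice stress tensor (Q) and the simplicity of subsequential limits (S), every probability measure
`μ` on `CurveClass ℂ` that is a weak subsequential limit of the critical `δℤ²` SAW laws in a
Dobrushin domain `(Ω; a, b)` is the chordal SLE(8/3) law: `IsSLELaw (8/3) D μ`.

## The cut — the route header's own two-layer plan "QuadrupoleIdentification ⇐ TObservablePassage →
## FarFieldClosing", with the Loewner regularity made explicit and the far field made MOMENT-FREE

The proof plan of the item is the CDHKS pipeline for the stress-tensor observable: (i) Loewner-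
parametrise the limit, (ii) pass the exact lattice martingales `n ↦ E[X_i(z) | γ[0,n]]/A_i(δ)` to
the limit with (Q), so that the h-free stress-tensor process `(iy g_t′(iy)/(g_t(iy) − W_t))²` is a
`μ`-martingale at every far point `iy`, (iii) read `W_t`, `W_t² − (8/3)t` off the far-field expansion
`(z g′/(g − W))² = 1 + 2W/z + (3W² − 8t)/z² + O(z⁻³)`, (iv) Lévy + the tree's PROVED
`isSLELaw_of_isLocalMartingale_driving_of_lt_four` (`κ = 8/3 < 4`). Three stubs:

* S1 `stub_loewnerDescription` (size L; Loewner REGULARITY of the limit) — every weak subsequential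
  limit `μ` of the SAW laws that is carried by simple chords meeting `∂Ω` only at `a, b` is, for every
  chordal uniformizer `φ : ℍ → Ω` (`0 ↦ a`, `∞ ↦ b`), `μ`-a.e. DESCRIBED BY THE LOEWNER EVOLUTION
  (`IsLoewnerDescribed φ c (W c)`) with a driving process `W : CurveClass ℂ → ℝ≥0 → ℝ` having Borel
  marginals, everywhere-continuous paths and `W c 0 = 0` (canonical choice: the tree's
  `drivingFunction φ c`, measurable by `measurable_drivingFunction_apply`, corrected by its time-0 value
  on the null junk set). CONTENT beyond bookkeeping: a described class has INFINITE total half-plane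
  capacity (`IsCompactifiedImage` of a trace on all of `ℝ≥0`), so S1 says the SAW limit does not creep
  into `b` tangentially along `∂Ω` (bounded capacity ⟺ the `ℍ`-pull-back escapes to `∞` inside
  horoball-like layers along `ℝ`) — for the UST Peano curve the tree needs a locally straight boundary
  at `b` for this (`ChordalCapacityDivergence.lean`); for SAW it is a Kemppainen–Smirnov Thm 1.5-type
  statement (Condition G2 is not available at `x_c`: no RSW), weaker than tightness, implied by the
  conjecture. Also source/target/`range ⊆ Ω̄` of the limit from portmanteau on closed sets, and the
  simple-curve ⇒ continuously-increasing-hulls ⇒ continuous Loewner transform step (Lawler 2005 §4.1,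
  Pommerenke boundary extension `exists_inverse_boundaryExtension`).
* S2 `stub_tObservablePassage` (size XL; THE PASSAGE, hardest) — under (Q) `SlitQuadrupoleShape`, for
  such `μ, φ, W`: there is a filtration `𝓕` of Borel sub-σ-algebras of the curve space with `W`
  strongly adapted such that, for all large levels `y`, the real and imaginary parts of the
  TIME-LIMITED h-free stress-tensor process
  `T^y_r(c) = (iy · g_σ′(iy)/(g_σ(iy) − W_σ(c)))²`, `σ = r ∧ y²/9` (`g = Loewner.map (W c)`, horizon
  `Loewner.cdhksTime y`, CDHKS's `T(z)`; before it the hull has height `≤ 2y/3`, so `z_y = φ(iy)` stays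
  at positive distance from the curve and `|T^y| ≤ 16`), are `𝓕`-martingales under `μ`. Mechanism: the
  Doob martingale `n ↦ E_δ[X_i(z_δ) | γ[0,n]]` of the SAW law (domain Markov of `x_c^{|γ|}`), sampled
  at capacity crossing times, equals `A_i(δ)(Re/Im S^δ_η(z_δ) + o(1))` uniformly over prefixes by (Q);
  the killed-random-walk shape `S^δ_η = (D_z log(G_η(·,b_δ)/G_η(·,v)))²` converges, uniformly over
  rough lattice slits at macroscopic distance from `z`, to `(ψ_η′/ψ_η)²(z) = ψ′(z)² g_t′(w)²/(g_t(w) − W_t)²`,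
  `w = ψ(z) = iy` (Kozdron–Lawler 2005 / Chelkak–Smirnov toolbox type input, UNVENDORED), and
  `T^y = (iy)²/ψ′(z)² ×` that, a deterministic multiple; bounded martingales pass to weak limits
  jointly with the curve (CDHKS 2014 §3; Duminil-Copin–Smirnov 2012, proof of Thm 3.13). Why it
  might fail: off the good event `E[X | η]/A(δ)` is unbounded (`A(δ) → 0`), the capacity
  parametrisation of LATTICE prefixes near `t = 0` with an interior `a_δ`, and the uniform slit-domain
  Green-gradient convergence is not in print for `ℤ²∖η` with `η` an arbitrary SAW.
* S3 `stub_tLocalDriver` (size M; PROVABLE NOW, continuum only) — the MOMENT-FREE far-field closing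
  for the spin-2 observable: for a real process `W` on any probability space, strongly adapted with
  continuous paths and `W_0 = 0`, if `Re T^y`, `Im T^y` are martingales for all `y ≥ y₀` then
  `X = (√(8/3))⁻¹ W` is a continuous local martingale with `⟨X⟩_t = t` (Lévy's format). This is the
  `(a, b, κ) = (2, 3, 8/3)` instance of the method of `SpinObservableLocalMartingale.lean` /
  `ObservableLocalMartingale.lean` (spin `κ = 3`, FK `κ = 16/3`): localise at `ρ_L = farStopTime W L`
  (`martingale_stoppedProcess_farStopTime`, `isLocalizingSequence_farStopTime`), expand at the doubly
  stopped clock (`Theorems/SAWStressTensorTMartingaleDriverExpansion.lean`: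
  `T = 1 + 2W/z + (3W² − 8t)/z² + O(((M + √t)/y)³)`), apply the general coefficient lemmas
  `integral_abs_condExp_stoppedDriver/Quad_sub_le_of_coeff`, let `y → ∞`. It REPLACES the route's
  support item `TMartingaleDriver` (stmt-7753, proved, which carries an `L³` running-supremum
  hypothesis) and thereby removes from the line the open estimate "L³ tails of `sup |W|` from
  simplicity alone" flagged in the item's why-it-might-fail: no moment of the driving process of a
  SAW subsequential limit is ever needed.

`QuadrupoleIdentification_of` (kernel-checked, no `sorry` of its own): fix `(D, a, b, s, μ)`, take a
chordal uniformizer (`MarkedDomain.exists_isChordalUniformizing_holds`, PROVED), get `W` from S1,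
`(𝓕, y₀)` from S2 (fed with (Q) and the simplicity hypothesis of the crux), Lévy's local format from S3
on `Ω := CurveClass ℂ`, and conclude with the tree's PROVED
`isSLELaw_of_isLocalMartingale_driving_of_lt_four` at `κ = 8/3 < 4` (`IsLoewnerDescribed` ⇒
`Loewner.IsDrivenBy`). No exponent (5/8, 2/3, 5/48) and no amplitude enters anywhere.

Disproof used: none — the crux has no `Disproof.lean` / `_false_without_` theorem / Negative lemma
(`ledger crux ls stmt-CriticalPhenomena-7752`: no workfiles, 2026-08-17). Negatives index
(`ledger negatives --problem CriticalPhenomena`, 11 entries) honoured: nothing here quantifies over all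
meshes (stmt-0772), no hexagonal observable limit (stmt-5420), no positivity claim (stmt-8261).
-/

noncomputable section

open MeasureTheory Filter Topology Set
open scoped NNReal
open UpperHalfPlane (upperHalfPlaneSet)
open Literature.Probability.RandomPlanarGeometry Literature.Probability.LatticeModels

namespace Summit.CriticalPhenomena.SAWScalingLimit.Cruxes.QuadrupoleIdentification.Birth

/-! ### Vocabulary of the line -/

/-- **The time-limited, h-free stress-tensor process at the far point `iy`**:
`T^y_r(ω) = (iy · g_σ′(iy) / (g_σ(iy) − W_σ(ω)))²`, `σ = r ∧ y²/9`, where `g = Loewner.map (W · ω)` is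
the chordal Loewner chain of the path and `Loewner.cdhksTime y = y²/9` is CDHKS's time horizon (the
hull has height `≤ 2y/3` before it). The square of `z g′/(g − W)` at `z = iy`: Doyon–Riva–Cardy's
`⟨T(w)⟩ = h (ψ′/ψ)²` with the weight `h` divided out; the fourth power of the tree's FK observable
`Loewner.observableProcess`. -/
def TObs {Ω : Type*} (W : ℝ≥0 → Ω → ℝ) (y : ℝ) (r : ℝ≥0) (ω : Ω) : ℂ :=
  (Complex.I * y * deriv (Loewner.map (fun u => W u ω) (min r (Loewner.cdhksTime y))) (Complex.I * y) /
    (Loewner.map (fun u => W u ω) (min r (Loewner.cdhksTime y)) (Complex.I * y) -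
      W (min r (Loewner.cdhksTime y)) ω)) ^ 2

/-- **S1, named.** Loewner description of simple subsequential SAW limits. -/
def LoewnerDescription : Prop :=
  ∀ (D : DobrushinDomain) (a b : ℝ → Site 2), SAW.IsEndpointApprox D a b →
    ∀ (s : ℕ → ℝ) (μ : Measure (CurveClass ℂ)), Tendsto s atTop (nhdsWithin 0 (Set.Ioi 0)) →
    IsProbabilityMeasure μ →
    (∀ f : BoundedContinuousFunction (CurveClass ℂ) ℝ,
      Tendsto (fun n => ∫ γ, f γ.curve ∂(SAW.law D.carrier (s n) (a (s n)) (b (s n)))) atTop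
        (nhds (∫ x, f x ∂μ))) →
    (∀ᵐ γ ∂μ, γ ∈ CurveClass.simple ∧ γ.range ∩ frontier D.carrier ⊆ {D.pt 0, D.pt 1}) →
    ∀ (φ : ConformalEquiv upperHalfPlaneSet D.carrier), D.IsChordalUniformizing φ →
    ∃ W : CurveClass ℂ → ℝ≥0 → ℝ, (∀ t, Measurable fun c => W c t) ∧ (∀ c, Continuous (W c)) ∧
      (∀ c, W c 0 = 0) ∧ ∀ᵐ c ∂μ, IsLoewnerDescribed φ c (W c)

/-- **S2, named.** The stress-tensor martingale passage under `SlitQuadrupoleShape`. -/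
def TObservablePassage : Prop :=
  Summit.CriticalPhenomena.SAWScalingLimit.Theses.SAWStressTensor.SlitQuadrupoleShape →
  ∀ (D : DobrushinDomain) (a b : ℝ → Site 2), SAW.IsEndpointApprox D a b →
    ∀ (s : ℕ → ℝ) (μ : Measure (CurveClass ℂ)), Tendsto s atTop (nhdsWithin 0 (Set.Ioi 0)) →
    IsProbabilityMeasure μ →
    (∀ f : BoundedContinuousFunction (CurveClass ℂ) ℝ,
      Tendsto (fun n => ∫ γ, f γ.curve ∂(SAW.law D.carrier (s n) (a (s n)) (b (s n)))) atTop
        (nhds (∫ x, f x ∂μ))) →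
    (∀ᵐ γ ∂μ, γ ∈ CurveClass.simple ∧ γ.range ∩ frontier D.carrier ⊆ {D.pt 0, D.pt 1}) →
    ∀ (φ : ConformalEquiv upperHalfPlaneSet D.carrier), D.IsChordalUniformizing φ →
    ∀ (W : CurveClass ℂ → ℝ≥0 → ℝ), (∀ t, Measurable fun c => W c t) → (∀ c, Continuous (W c)) →
      (∀ c, W c 0 = 0) → (∀ᵐ c ∂μ, IsLoewnerDescribed φ c (W c)) →
    ∃ 𝓕 : Filtration ℝ≥0 (inferInstance : MeasurableSpace (CurveClass ℂ)),
      StronglyAdapted 𝓕 (fun t c => W c t) ∧ ∃ y₀ : ℝ, ∀ y : ℝ, y₀ ≤ y →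
        Martingale (fun r c => (TObs (fun t c => W c t) y r c).re) 𝓕 μ ∧
        Martingale (fun r c => (TObs (fun t c => W c t) y r c).im) 𝓕 μ

/-- **S3, named.** The moment-free far-field closing for the spin-2 observable (Lévy's format,
`κ = 8/3`). -/
def TLocalDriver : Prop :=
  ∀ (Ω : Type) (mΩ : MeasurableSpace Ω) (P : Measure Ω) (𝓕 : Filtration ℝ≥0 mΩ) (W : ℝ≥0 → Ω → ℝ),
    IsProbabilityMeasure P → StronglyAdapted 𝓕 W → (∀ ω, Continuous (W · ω)) → (∀ ω, W 0 ω = 0) →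
    ∀ y₀ : ℝ, (∀ y, y₀ ≤ y → Martingale (fun r ω => (TObs W y r ω).re) 𝓕 P) →
      (∀ y, y₀ ≤ y → Martingale (fun r ω => (TObs W y r ω).im) 𝓕 P) →
      IsLocalMartingale (fun t ω => (Real.sqrt (8 / 3))⁻¹ * W t ω) 𝓕 P ∧
        Literature.Probability.Process.HasQuadraticVariation
          (fun t ω => (Real.sqrt (8 / 3))⁻¹ * W t ω) (fun t _ => (t : ℝ)) 𝓕 P

/-! ### The stubs (the ONLY `sorry`s of this file)

Each stub is stated over TREE VOCABULARY ONLY (`TObs` unfolded by hand), so that it lands verbatim as a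
`Theorems/SAWStressTensorQuadrupoleIdentification<Stub>.lean --supports stmt-CriticalPhenomena-7752`
without importing this workfile; the `*_holds` theorems below certify definitionally that the unfolded
text IS the named statement. -/

/-- **S1 — Loewner description of simple subsequential SAW limits** (size L). For every Dobrushin
domain, endpoint approximation, meshes `s_n → 0⁺` and probability weak limit `μ` of the critical SAW
curve laws along `s_n` that is carried by simple curves meeting `∂Ω` only at `a, b`, and every chordal
uniformizer `φ`: there is a driving process `W` on the curve space with Borel marginals,
everywhere-continuous paths and `W c 0 = 0` such that `μ`-a.e. class `c` is described by the Loewner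
evolution through `φ` with driving function `W c`. Content: endpoints and `range ⊆ Ω̄` of the limit
(portmanteau on closed sets); simple chord ⇒ continuously increasing `ℍ`-hulls ⇒ continuous Loewner
transform (Lawler 2005 §4.1; `exists_inverse_boundaryExtension`); DIVERGENCE OF THE TOTAL HALF-PLANE
CAPACITY at `b` (no tangential creeping of the SAW limit into `b` — the genuinely probabilistic part;
cf. `ChordalCapacityDivergence.lean` for the UST, Kemppainen–Smirnov 2017 Thm 1.5); canonical choice
`W c = drivingFunction φ c − drivingFunction φ c 0` (`measurable_drivingFunction_apply`,
`continuous_drivingFunction`, `ae_drivingFunction_apply_zero`, `driving_unique_holds`). -/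
theorem stub_loewnerDescription :
    ∀ (D : DobrushinDomain) (a b : ℝ → Site 2), SAW.IsEndpointApprox D a b →
    ∀ (s : ℕ → ℝ) (μ : Measure (CurveClass ℂ)), Tendsto s atTop (nhdsWithin 0 (Set.Ioi 0)) →
    IsProbabilityMeasure μ →
    (∀ f : BoundedContinuousFunction (CurveClass ℂ) ℝ,
      Tendsto (fun n => ∫ γ, f γ.curve ∂(SAW.law D.carrier (s n) (a (s n)) (b (s n)))) atTop
        (nhds (∫ x, f x ∂μ))) →
    (∀ᵐ γ ∂μ, γ ∈ CurveClass.simple ∧ γ.range ∩ frontier D.carrier ⊆ {D.pt 0, D.pt 1}) →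
    ∀ (φ : ConformalEquiv upperHalfPlaneSet D.carrier), D.IsChordalUniformizing φ →
    ∃ W : CurveClass ℂ → ℝ≥0 → ℝ, (∀ t, Measurable fun c => W c t) ∧ (∀ c, Continuous (W c)) ∧
      (∀ c, W c 0 = 0) ∧ ∀ᵐ c ∂μ, IsLoewnerDescribed φ c (W c) := by
  sorry

/-- **S2 (hardest) — the stress-tensor martingale passage** (size XL). Under `SlitQuadrupoleShape`:
for every such `(D, a, b, s, μ)`, chordal uniformizer `φ` and driving process `W` as delivered by S1,
there is a filtration `𝓕` of Borel sub-σ-algebras of `CurveClass ℂ` with `W` strongly adapted and a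
level `y₀` such that for every `y ≥ y₀` the real and imaginary parts of the time-limited h-free
stress-tensor process `r ↦ (iy g_σ′(iy)/(g_σ(iy) − W_σ))²`, `σ = r ∧ y²/9`, `g = Loewner.map (W c)`,
are `𝓕`-martingales under `μ`. Mechanism: Doob martingale `E_δ[X_i(z_δ) | γ[0,n]]` of the SAW law
sampled at capacity crossing times; `SlitQuadrupoleShape` (discrete shape, uniform over prefixes, at
`z_δ → z_y = φ(iy)`, which is `ρ(y)`-inside `Ω` and `ρ(y)`-away from `b_δ` and from every prefix of
capacity `≤ y²/9`); convergence of the killed-RW shape `(D_z log(G_η(·,b_δ)/G_η(·,v)))²` to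
`ψ′(z)² g_t′(iy)²/(g_t(iy) − W_t)²` uniformly over rough lattice slits (Kozdron–Lawler-type, unvendored);
`T^y` is the deterministic multiple `(iy)²/ψ′(z)²` of it; bounded (`|T^y| ≤ 16`) martingales pass to
the weak limit jointly with the curve (CDHKS 2014 §3). -/
theorem stub_tObservablePassage :
    Summit.CriticalPhenomena.SAWScalingLimit.Theses.SAWStressTensor.SlitQuadrupoleShape →
    ∀ (D : DobrushinDomain) (a b : ℝ → Site 2), SAW.IsEndpointApprox D a b →
    ∀ (s : ℕ → ℝ) (μ : Measure (CurveClass ℂ)), Tendsto s atTop (nhdsWithin 0 (Set.Ioi 0)) →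
    IsProbabilityMeasure μ →
    (∀ f : BoundedContinuousFunction (CurveClass ℂ) ℝ,
      Tendsto (fun n => ∫ γ, f γ.curve ∂(SAW.law D.carrier (s n) (a (s n)) (b (s n)))) atTop
        (nhds (∫ x, f x ∂μ))) →
    (∀ᵐ γ ∂μ, γ ∈ CurveClass.simple ∧ γ.range ∩ frontier D.carrier ⊆ {D.pt 0, D.pt 1}) →
    ∀ (φ : ConformalEquiv upperHalfPlaneSet D.carrier), D.IsChordalUniformizing φ →
    ∀ (W : CurveClass ℂ → ℝ≥0 → ℝ), (∀ t, Measurable fun c => W c t) → (∀ c, Continuous (W c)) →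
      (∀ c, W c 0 = 0) → (∀ᵐ c ∂μ, IsLoewnerDescribed φ c (W c)) →
    ∃ 𝓕 : Filtration ℝ≥0 (inferInstance : MeasurableSpace (CurveClass ℂ)),
      StronglyAdapted 𝓕 (fun t c => W c t) ∧ ∃ y₀ : ℝ, ∀ y : ℝ, y₀ ≤ y →
        Martingale (fun r c => ((Complex.I * y *
            deriv (Loewner.map (fun u => W c u) (min r (Loewner.cdhksTime y))) (Complex.I * y) /
          (Loewner.map (fun u => W c u) (min r (Loewner.cdhksTime y)) (Complex.I * y) -
            W c (min r (Loewner.cdhksTime y)))) ^ 2).re) 𝓕 μ ∧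
        Martingale (fun r c => ((Complex.I * y *
            deriv (Loewner.map (fun u => W c u) (min r (Loewner.cdhksTime y))) (Complex.I * y) /
          (Loewner.map (fun u => W c u) (min r (Loewner.cdhksTime y)) (Complex.I * y) -
            W c (min r (Loewner.cdhksTime y)))) ^ 2).im) 𝓕 μ := by
  sorry

/-- **S3 — the moment-free far-field closing for the spin-2 observable, Lévy's format** (size M,
provable now; continuum only, no lattice). For a real process `W` indexed by `ℝ≥0` on a probability
space, strongly adapted to `𝓕`, with continuous paths and `W_0 = 0`: if for all `y ≥ y₀` the real and
imaginary parts of the time-limited stress-tensor process `(iy g_σ′(iy)/(g_σ(iy) − W_σ))²`,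
`σ = r ∧ y²/9`, are `𝓕`-martingales, then `X = (√(8/3))⁻¹ W` is a continuous local martingale with
quadratic variation `⟨X⟩_t = t`. Method of `Loewner.isLocalMartingale_hasQuadraticVariation_of_fkObservable`
/ `…_of_spinObservable` with the expansion `(z g′/(g − W))² = 1 + 2W/z + (3W² − 8t)/z² + O(α³)`
(`Theorems/SAWStressTensorTMartingaleDriverExpansion.lean`): coefficients `(a, b, κ) = (2, 3, 8/3)`;
localisation at `farStopTime W L`, optional stopping `martingale_stoppedProcess_farStopTime`,
`integral_abs_condExp_stoppedDriver_sub_le_of_coeff` / `…stoppedQuad…`, `y → ∞`,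
`isLocalizingSequence_farStopTime`. No moment hypothesis — this is what lets the line drop the `L³`
clause of the proved support item `TMartingaleDriver` (stmt-7753). -/
theorem stub_tLocalDriver :
    ∀ (Ω : Type) (mΩ : MeasurableSpace Ω) (P : Measure Ω) (𝓕 : Filtration ℝ≥0 mΩ)
      (W : ℝ≥0 → Ω → ℝ),
    IsProbabilityMeasure P → StronglyAdapted 𝓕 W → (∀ ω, Continuous (W · ω)) → (∀ ω, W 0 ω = 0) →
    ∀ y₀ : ℝ,
    (∀ y, y₀ ≤ y → Martingale (fun r ω => ((Complex.I * y *
            deriv (Loewner.map (fun u => W u ω) (min r (Loewner.cdhksTime y))) (Complex.I * y) /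
          (Loewner.map (fun u => W u ω) (min r (Loewner.cdhksTime y)) (Complex.I * y) -
            W (min r (Loewner.cdhksTime y)) ω)) ^ 2).re) 𝓕 P) →
    (∀ y, y₀ ≤ y → Martingale (fun r ω => ((Complex.I * y *
            deriv (Loewner.map (fun u => W u ω) (min r (Loewner.cdhksTime y))) (Complex.I * y) /
          (Loewner.map (fun u => W u ω) (min r (Loewner.cdhksTime y)) (Complex.I * y) -
            W (min r (Loewner.cdhksTime y)) ω)) ^ 2).im) 𝓕 P) →
    IsLocalMartingale (fun t ω => (Real.sqrt (8 / 3))⁻¹ * W t ω) 𝓕 P ∧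
      Literature.Probability.Process.HasQuadraticVariation
        (fun t ω => (Real.sqrt (8 / 3))⁻¹ * W t ω) (fun t _ => (t : ℝ)) 𝓕 P := by
  sorry

/-! ### Consistency: each named statement IS its registered stub (definitionally) -/

theorem loewnerDescription_holds : LoewnerDescription := stub_loewnerDescription
theorem tObservablePassage_holds : TObservablePassage := stub_tObservablePassage
theorem tLocalDriver_holds : TLocalDriver := stub_tLocalDriver

/-! ### Name-keyed aliases of the three statements — the hypotheses of `QuadrupoleIdentification_of`

The native skeleton audit (`#h21_check_skeleton`) admits a hypothesis of the skeleton theorem only if its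
head constant is a registered obligation or is NAMED like a declared stub; `__Registered.stub_X` is the
statement of `stub_X` under that name (device of `Cruxes/AxiomsOfLimit/Lines/birth.lean`; the `__`
namespace is an implementation detail, so the audit's stub report resolves each `stub_…` to the sorried
theorem, not to the alias). Each alias is `rfl`-equal to its statement. -/
namespace __Registered

/-- Alias of `LoewnerDescription` keyed by the registered stub name. -/
abbrev stub_loewnerDescription : Prop := LoewnerDescription
/-- Alias of `TObservablePassage` keyed by the registered stub name. -/
abbrev stub_tObservablePassage : Prop := TObservablePassage
/-- Alias of `TLocalDriver` keyed by the registered stub name. -/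
abbrev stub_tLocalDriver : Prop := TLocalDriver

end __Registered

/-- `8/3 < 4` in `ℝ≥0` (the SAW parameter lies in the simple-curve range of Rohde–Schramm). -/
theorem eight_thirds_lt_four' : (8 : ℝ≥0) / 3 < 4 := by
  rw [div_lt_iff₀ (by norm_num : (0 : ℝ≥0) < 3)]
  norm_num

/-! ### The skeleton theorem: the three stubs imply the crux, BY NAME -/

/-- **`QuadrupoleIdentification` from the line `birth`** (kernel-checked, no `sorry` of its own).
Fix a Dobrushin domain, an endpoint approximation, meshes `s_n → 0⁺` and a probability weak limit
`μ`; the crux's second hypothesis gives simplicity; take a chordal uniformizer `φ`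
(`MarkedDomain.exists_isChordalUniformizing_holds`); S1 gives the driving process `W`; S2 (fed with
`SlitQuadrupoleShape`) gives the filtration and the stress-tensor martingales at all large levels; S3
on `Ω := CurveClass ℂ` turns them into Lévy's local format for `(√(8/3))⁻¹ W`; the tree's PROVED
`isSLELaw_of_isLocalMartingale_driving_of_lt_four` (`κ = 8/3 < 4`; Lévy, existence and transience of
the SLE trace all discharged there) identifies `μ` as the chordal SLE(8/3) law. -/
theorem QuadrupoleIdentification_of (h₁ : __Registered.stub_loewnerDescription)
    (h₂ : __Registered.stub_tObservablePassage) (h₃ : __Registered.stub_tLocalDriver) :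
    Summit.CriticalPhenomena.SAWScalingLimit.Theses.SAWStressTensor.QuadrupoleIdentification := by
  intro hQ hS D a b hab s μ hs hμ hlim
  have hsimple := hS D a b hab s μ hs hμ hlim
  obtain ⟨φ, hφ⟩ := MarkedDomain.exists_isChordalUniformizing_holds D
  obtain ⟨W, hWm, hWc, hW0, hdesc⟩ := h₁ D a b hab s μ hs hμ hlim hsimple φ hφ
  obtain ⟨𝓕, hWad, y₀, hmart⟩ :=
    h₂ hQ D a b hab s μ hs hμ hlim hsimple φ hφ W hWm hWc hW0 hdesc
  obtain ⟨hM, hQV⟩ := h₃ (CurveClass ℂ) inferInstance μ 𝓕 (fun t c => W c t) hμ hWad hWc hW0 y₀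
    (fun y hy => (hmart y hy).1) (fun y hy => (hmart y hy).2)
  haveI := hμ
  have hsq : Real.sqrt (((8 : ℝ≥0) / 3 : ℝ≥0) : ℝ) = Real.sqrt (8 / 3) := by
    norm_num [NNReal.coe_div]
  refine isSLELaw_of_isLocalMartingale_driving_of_lt_four (κ := (8 : ℝ≥0) / 3) (by positivity)
    eight_thirds_lt_four' hφ hWm (ae_of_all _ hW0) (ae_of_all _ hWc) (𝓕 := 𝓕) ?_ ?_ ?_
  · simpa only [hsq] using hM
  · simpa only [hsq] using hQV
  · filter_upwards [hdesc] with c hc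
    obtain ⟨-, γ, hγ, c', hc', hI⟩ := hc
    exact ⟨γ, hγ, c', hc', hI⟩

/-- Wiring check (an `example`, so that `QuadrupoleIdentification_of` stays the only theorem concluding
the crux): the registered stubs, with their tree-vocabulary types, feed the skeleton theorem as stated —
this term becomes the crux proof when the three `sorry`s above are discharged. -/
example : Summit.CriticalPhenomena.SAWScalingLimit.Theses.SAWStressTensor.QuadrupoleIdentification :=
  QuadrupoleIdentification_of stub_loewnerDescription stub_tObservablePassage stub_tLocalDriver

end Summit.CriticalPhenomena.SAWScalingLimit.Cruxes.QuadrupoleIdentification.Birth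

end
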